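import Summits.Ventures.QEC.Thresholds.PhenomenologicalBoxThresholds
import Literature.InformationTheory.QuantumCodes.MatchingDecodersBoundary
import Literature.InformationTheory.QuantumCodes.MatchingDecodersExistence
import Literature.InformationTheory.QuantumCodes.CSSPhenomenologicalDepolarizing
import HarnessLib

/-!
# MWPM for EVERY census CSS family whose checks meet each qubit at most twice (graphlike with boundary): the boundary-MWPM
# decoder class attains the certified minimum-weight thresholds `p₀(w-1)` (code capacity), `p₀(w+1)` (phenomenological, two-rate
# box) and the three-rate box — UNCONDITIONAL, kernel

Venture QEC, `Summits/Ventures/QEC/Thresholds/` (LADDER-QEC rung Q5 «(family, DECODER, noise)», PARTITION row 09; qec-type-09 gen 5).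
`CSSFamilyThresholds.lean` / `PhenomenologicalBoxThresholds.lean` certify, for every census CSS family with `X`-checks of weight `≤ w`,
`Z`-logicals of weight `≥ d i → ∞` fast enough, thresholds `p₀(w-1)` (code capacity) and `p₀(w+1)` (`T i` noisy rounds) for EVERY
MINIMUM-WEIGHT (space-time) decoder family (Dumer–Kovalev–Pryadko). qec-type-09 gen 4's `MatchingDecodersBoundary.lean` proves that when a
check matrix `H` meets each qubit at most twice (`colSupp`, `exists_isGraphlikeVia_of_card_colSupp_le_two`: a link-end map
`ι : Q → Sym2 (Option R)` with a virtual BOUNDARY vertex presents `H`), every matching decoder with boundary (`boundaryDecoder D'`, any link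
metric, tie-break, geodesics) is minimum-weight (`isMinWeight_boundaryDecoder`; in space-time `isMinWeight_boundaryDecoder_st` with
`stEndsOf ι T`, Korte–Vygen Thm 12.9). This file states the consequence once for all such families (planar / surface codes with boundaries,
toric codes, any «each qubit in ≤ 2 checks of the type» family):

| theorem | statement (`Z` sector; graphlike presentations `ι i` of `(C i).HX`, boundary-MWPM decoders) |
|---|---|
| `css_z_mwpm_isThresholdLowerBound_of_rowWeight` | code capacity: threshold `≥ p₀(w-1)` |
| `css_z_phenom_mwpm_isThresholdLowerBound_of_rowWeight`, `css_z_phenom_mwpm_isThresholdBoxLowerBound_of_rowWeight` | `T i` noisy rounds: `≥ p₀(w+1)` (`q = p`), two-rate box `p₀(w+1)` |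
| `css_depolPhenom_mwpm_belowThreshold_of_rowWeight` | three-rate phenomenological depolarizing, boundary-MWPM on BOTH records (graphlike `H^X` and `H^Z`): `p < (3/2)·min(p₀(w_X+1), p₀(w_Z+1))`, `q_X < p₀(w_X+1)`, `q_Z < p₀(w_Z+1)` ⇒ `P_fail → 0` |
| `exists_isGraphlikeVia_family`, `exists_boundary_mwpm_family` | non-vacuity: column weights `≤ 2` ⇒ presentations and boundary-MWPM families exist |

(`X`-sector twins by `C i ↦ (C i).swap`.) All UNCONDITIONAL, tier CERTIFIED (kernel), axioms standard, 0 named facts. Theorem-only file.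

## References

* [KorteVygen2002] B. Korte, J. Vygen, *Combinatorial Optimization* (2002), §12.2 Thm 12.9.
* [DennisEtAl2002] E. Dennis, A. Kitaev, A. Landahl, J. Preskill, J. Math. Phys. 43 (2002) 4452, §3.2 (each link in at most two
  sites / plaquettes; boundaries), §4.4 p. 18, §5.1 p. 19.
* [DumerKovalevPryadko2015] I. Dumer, A. A. Kovalev, L. P. Pryadko, PRL 115 (2015) 050502, Thms 2–3 with p. 5.
* [AliferisGottesmanPreskill2006] P. Aliferis, D. Gottesman, J. Preskill, arXiv:quant-ph/0504218, §8.2 (chunk p0026 L11: depolarizing).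
-/

noncomputable section

namespace Summit.Ventures.QEC.Thresholds

open Filter Topology Finset Matrix
open Literature.InformationTheory.QuantumCodes

variable {RX RZ Q : ℕ → Type*} [∀ i, Fintype (Q i)] [∀ i, DecidableEq (Q i)] [∀ i, Fintype (RX i)] [∀ i, DecidableEq (RX i)]
  [∀ i, Fintype (RZ i)] [∀ i, DecidableEq (RZ i)]

/-! ### Code capacity -/

omit [∀ i, DecidableEq (RZ i)] in
/-- **Boundary-MWPM attains the minimum-weight code-capacity threshold `p₀(w-1)`**: census CSS family with `X`-checks of weight `≤ w`
(`w ≥ 2`), `Z`-logicals of weight `≥ d i ≥ 1`, `n_i r^{d_i} → 0`; for all graphlike-with-boundary presentations `ι i` of `(C i).HX`, all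
link metrics and all matching decoders `D' i`. UNCONDITIONAL. [cite: KorteVygen2002, §12.2 Thm 12.9] [cite: DumerKovalevPryadko2015, Thm 2 (y = 0)] -/
theorem css_z_mwpm_isThresholdLowerBound_of_rowWeight (C : ∀ i, CSSCode (RX i) (RZ i) (Q i))
    {ι : ∀ i, Q i → Sym2 (Option (RX i))} (hι : ∀ i, IsGraphlikeVia (C i).HX (ι i))
    (m : ∀ i, EdgeMetric (ι i)) {D' : ∀ i, Decoder (Option (RX i) → ZMod 2) (Q i → ZMod 2)}
    (hD : ∀ i, IsMatchingDecoder (m i) (D' i))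
    {w : ℕ} (hw : 2 ≤ w) (hrow : ∀ i x, (rowSupp (C i).HX x).card ≤ w) (d : ℕ → ℕ) (hd1 : ∀ i, 1 ≤ d i)
    (hd : ∀ i (x : Q i → ZMod 2), (C i).HX *ᵥ x = 0 → x ∉ (C i).rowSpZ → d i ≤ hammingNorm x)
    (hgrowth : ∀ r : ℝ, 0 < r → r < 1 → Tendsto (fun i => (Fintype.card (Q i) : ℝ) * r ^ d i) atTop (𝓝 0)) :
    IsThresholdLowerBound (zFailureFamily C fun i => boundaryDecoder (D' i)) (thresholdValue ((w - 1 : ℕ) : ℝ)) :=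
  z_isThresholdLowerBound_of_rowWeight C _ (fun i => isMinWeight_boundaryDecoder (hι i) (hD i)) hw hrow d hd1 hd hgrowth

/-! ### Noisy measurement -/

omit [∀ i, DecidableEq (RZ i)] in
/-- **Space-time boundary-MWPM attains the minimum-weight phenomenological threshold `p₀(w+1)`** (`q = p`, schedule `T i`), for all
graphlike-with-boundary presentations of `(C i).HX`, all link metrics on the space-time checks and all matching decoders. UNCONDITIONAL.
[cite: KorteVygen2002, §12.2 Thm 12.9] [cite: DumerKovalevPryadko2015, Thm 3 with p. 5 (w → w + 2)] -/
theorem css_z_phenom_mwpm_isThresholdLowerBound_of_rowWeight (C : ∀ i, CSSCode (RX i) (RZ i) (Q i)) (T : ℕ → ℕ)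
    {ι : ∀ i, Q i → Sym2 (Option (RX i))} (hι : ∀ i, IsGraphlikeVia (C i).HX (ι i))
    (m : ∀ i, EdgeMetric (stEndsOf (ι i) (T i)))
    {D' : ∀ i, Decoder (Option (RX i × Fin (T i + 1)) → ZMod 2) (HistoryLoc (Q i) (RX i) (T i) → ZMod 2)}
    (hD : ∀ i, IsMatchingDecoder (m i) (D' i))
    {w : ℕ} (hrow : ∀ i x, (rowSupp (C i).HX x).card ≤ w) (d : ℕ → ℕ) (hd1 : ∀ i, 1 ≤ d i)
    (hd : ∀ i (x : Q i → ZMod 2), (C i).HX *ᵥ x = 0 → x ∉ (C i).rowSpZ → d i ≤ hammingNorm x)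
    (hgrowth : ∀ r : ℝ, 0 < r → r < 1 →
      Tendsto (fun i => (((Fintype.card (Q i) + Fintype.card (RX i)) * T i : ℕ) : ℝ) * r ^ d i) atTop (𝓝 0)) :
    IsThresholdLowerBound (zPhenomFailureFamily C T fun i => boundaryDecoder (D' i)) (thresholdValue ((w + 1 : ℕ) : ℝ)) :=
  z_phenom_isThresholdLowerBound_of_rowWeight C T _ (fun i => isMinWeight_boundaryDecoder_st (hι i) (T i) (hD i)) hrow d hd1
    hd hgrowth

omit [∀ i, DecidableEq (RZ i)] in
/-- **Two-rate box `p₀(w+1)` for space-time boundary-MWPM** (rates `p`, `q`). UNCONDITIONAL.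
[cite: KorteVygen2002, §12.2 Thm 12.9] [cite: DumerKovalevPryadko2015, Thm 3 with p. 5] -/
theorem css_z_phenom_mwpm_isThresholdBoxLowerBound_of_rowWeight (C : ∀ i, CSSCode (RX i) (RZ i) (Q i)) (T : ℕ → ℕ)
    {ι : ∀ i, Q i → Sym2 (Option (RX i))} (hι : ∀ i, IsGraphlikeVia (C i).HX (ι i))
    (m : ∀ i, EdgeMetric (stEndsOf (ι i) (T i)))
    {D' : ∀ i, Decoder (Option (RX i × Fin (T i + 1)) → ZMod 2) (HistoryLoc (Q i) (RX i) (T i) → ZMod 2)}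
    (hD : ∀ i, IsMatchingDecoder (m i) (D' i))
    {w : ℕ} (hrow : ∀ i x, (rowSupp (C i).HX x).card ≤ w) (d : ℕ → ℕ) (hd1 : ∀ i, 1 ≤ d i)
    (hd : ∀ i (x : Q i → ZMod 2), (C i).HX *ᵥ x = 0 → x ∉ (C i).rowSpZ → d i ≤ hammingNorm x)
    (hgrowth : ∀ r : ℝ, 0 < r → r < 1 →
      Tendsto (fun i => (((Fintype.card (Q i) + Fintype.card (RX i)) * T i : ℕ) : ℝ) * r ^ d i) atTop (𝓝 0)) :
    IsThresholdBoxLowerBound (zPhenomFailureFamily₂ C T fun i => boundaryDecoder (D' i)) (thresholdValue ((w + 1 : ℕ) : ℝ)) :=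
  z_phenom_isThresholdBoxLowerBound_of_rowWeight C T _ (fun i => isMinWeight_boundaryDecoder_st (hι i) (T i) (hD i)) hrow d hd1
    hd hgrowth

/-! ### Three rates, both records -/

/-- **Three-rate phenomenological depolarizing noise, boundary-MWPM on BOTH records** of a census CSS family with graphlike `H^X` (weight
`≤ w_X`) and graphlike `H^Z` (weight `≤ w_Z`), sector distances `≥ d_Z(i), d_X(i) ≥ 1`, subexponential space-time volumes:
`0 ≤ p < (3/2)·min(p₀(w_X+1), p₀(w_Z+1))` (`p ≤ 1`), `0 ≤ q_X < p₀(w_X+1)`, `0 ≤ q_Z < p₀(w_Z+1)` (`≤ 1`) ⇒ `P_fail → 0`. UNCONDITIONAL.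
[cite: KorteVygen2002, §12.2 Thm 12.9] [cite: DumerKovalevPryadko2015, Thm 3 with p. 5 and eq. (succesful-decoding-depolarizing)]
[cite: AliferisGottesmanPreskill2006, §8.2 (chunk p0026 L11)] -/
theorem css_depolPhenom_mwpm_belowThreshold_of_rowWeight (C : ∀ i, CSSCode (RX i) (RZ i) (Q i)) (T : ℕ → ℕ)
    {ιZ : ∀ i, Q i → Sym2 (Option (RX i))} (hιZ : ∀ i, IsGraphlikeVia (C i).HX (ιZ i))
    {ιX : ∀ i, Q i → Sym2 (Option (RZ i))} (hιX : ∀ i, IsGraphlikeVia (C i).HZ (ιX i))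
    (mZ : ∀ i, EdgeMetric (stEndsOf (ιZ i) (T i))) (mX : ∀ i, EdgeMetric (stEndsOf (ιX i) (T i)))
    {DZ' : ∀ i, Decoder (Option (RX i × Fin (T i + 1)) → ZMod 2) (HistoryLoc (Q i) (RX i) (T i) → ZMod 2)}
    {DX' : ∀ i, Decoder (Option (RZ i × Fin (T i + 1)) → ZMod 2) (HistoryLoc (Q i) (RZ i) (T i) → ZMod 2)}
    (hDZ : ∀ i, IsMatchingDecoder (mZ i) (DZ' i)) (hDX : ∀ i, IsMatchingDecoder (mX i) (DX' i))
    {wX wZ : ℕ} (hrowX : ∀ i x, (rowSupp (C i).HX x).card ≤ wX) (hrowZ : ∀ i x, (rowSupp (C i).HZ x).card ≤ wZ)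
    (dZ dX : ℕ → ℕ) (hdZ1 : ∀ i, 1 ≤ dZ i) (hdX1 : ∀ i, 1 ≤ dX i)
    (hdZ : ∀ i (x : Q i → ZMod 2), (C i).HX *ᵥ x = 0 → x ∉ (C i).rowSpZ → dZ i ≤ hammingNorm x)
    (hdX : ∀ i (x : Q i → ZMod 2), (C i).HZ *ᵥ x = 0 → x ∉ (C i).rowSpX → dX i ≤ hammingNorm x)
    (hgrowthZ : ∀ r : ℝ, 0 < r → r < 1 →
      Tendsto (fun i => (((Fintype.card (Q i) + Fintype.card (RX i)) * T i : ℕ) : ℝ) * r ^ dZ i) atTop (𝓝 0))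
    (hgrowthX : ∀ r : ℝ, 0 < r → r < 1 →
      Tendsto (fun i => (((Fintype.card (Q i) + Fintype.card (RZ i)) * T i : ℕ) : ℝ) * r ^ dX i) atTop (𝓝 0))
    {p qX qZ : ℝ} (hp0 : 0 ≤ p) (hp1 : p ≤ 1)
    (hp : p < 3 / 2 * min (thresholdValue ((wX + 1 : ℕ) : ℝ)) (thresholdValue ((wZ + 1 : ℕ) : ℝ)))
    (hqX0 : 0 ≤ qX) (hqX1 : qX ≤ 1) (hqX : qX < thresholdValue ((wX + 1 : ℕ) : ℝ))
    (hqZ0 : 0 ≤ qZ) (hqZ1 : qZ ≤ 1) (hqZ : qZ < thresholdValue ((wZ + 1 : ℕ) : ℝ)) :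
    Tendsto (fun i => (C i).depolPhenomFailureProb (T i) (boundaryDecoder (DZ' i)) (boundaryDecoder (DX' i)) p qX qZ)
      atTop (𝓝 0) :=
  CSSCode.depolPhenom_belowThreshold_of_boxes C T _ _
    (z_phenom_isThresholdBoxLowerBound_of_rowWeight C T _ (fun i => isMinWeight_boundaryDecoder_st (hιZ i) (T i) (hDZ i))
      hrowX dZ hdZ1 hdZ hgrowthZ)
    (x_phenom_isThresholdBoxLowerBound_of_rowWeight C T _ (fun i => isMinWeight_boundaryDecoder_st (hιX i) (T i) (hDX i))
      hrowZ dX hdX1 hdX hgrowthX)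
    hp0 hp1 hp hqX0 hqX1 hqX hqZ0 hqZ1 hqZ

/-! ### Non-vacuity -/

omit [∀ i, DecidableEq (Q i)] [∀ i, Fintype (RZ i)] [∀ i, DecidableEq (RZ i)] in
/-- **Graphlike presentations exist** for a family whose `X`-checks meet every qubit at most twice.
[cite: DennisEtAl2002, §3.2 (each link belongs to at most two sites)] -/
theorem exists_isGraphlikeVia_family (C : ∀ i, CSSCode (RX i) (RZ i) (Q i))
    (hcol : ∀ i q, (colSupp (C i).HX q).card ≤ 2) :
    ∃ ι : ∀ i, Q i → Sym2 (Option (RX i)), ∀ i, IsGraphlikeVia (C i).HX (ι i) := by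
  choose ι hι using fun i => exists_isGraphlikeVia_of_card_colSupp_le_two (C i).HX (hcol i)
  exact ⟨ι, hι⟩

omit [∀ i, Fintype (RZ i)] [∀ i, DecidableEq (RZ i)] in
/-- **Boundary-MWPM families exist** (extended chain metrics, code capacity and space-time) for every family whose `X`-checks meet every
qubit at most twice — the decoder class of the theorems above is inhabited. [cite: KorteVygen2002, §12.2 Thm 12.9 with Prop 12.6] -/
theorem exists_boundary_mwpm_family (C : ∀ i, CSSCode (RX i) (RZ i) (Q i)) (T : ℕ → ℕ)
    (hcol : ∀ i q, (colSupp (C i).HX q).card ≤ 2) :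
    ∃ (ι : ∀ i, Q i → Sym2 (Option (RX i))) (D' : ∀ i, Decoder (Option (RX i) → ZMod 2) (Q i → ZMod 2))
      (DT' : ∀ i, Decoder (Option (RX i × Fin (T i + 1)) → ZMod 2) (HistoryLoc (Q i) (RX i) (T i) → ZMod 2)),
      (∀ i, IsGraphlikeVia (C i).HX (ι i)) ∧ (∀ i, IsMatchingDecoder (extMetric (ι i)) (D' i)) ∧
        ∀ i, IsMatchingDecoder (extMetric (stEndsOf (ι i) (T i))) (DT' i) := by
  obtain ⟨ι, hι⟩ := exists_isGraphlikeVia_family C hcol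
  choose D' hD' using fun i => exists_isMatchingDecoder_extMetric (ι := ι i)
  choose DT' hDT' using fun i => exists_isMatchingDecoder_extMetric (ι := stEndsOf (ι i) (T i))
  exact ⟨ι, D', DT', hι, hD', hDT'⟩

end Summit.Ventures.QEC.Thresholds

end
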